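import Summits.HodgeConjecture.HodgeConjecture.Theorems.NikulinTwinTransportTwinTwistorTransportPeriodInvariance
import Summits.HodgeConjecture.HodgeConjecture.Theorems.NikulinTwinTransportHodgeSimilitudeAlgebraicCmSelfSimilitude
import Summits.HodgeConjecture.HodgeConjecture.Theses.NikulinTwinTransport
import Literature.AlgebraicGeometry.Surfaces.K3HodgeTypesHolds
import Literature.AlgebraicGeometry.Surfaces.K3SurfaceBuskinLeaves
import Literature.AlgebraicGeometry.HodgeTheory.GysinBaseChange
import Literature.AlgebraicGeometry.Surfaces.K3ComplexMultiplication
import Literature.NumberTheory.Transcendental.DeRhamTheorem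

/-!
# Route NikulinTwinTransport · crux `TwinTwistorTransport` (stmt-HodgeConjecture-14393) —
# line `ordinary-prime-anchors`, stub `stub_cmTwinAnchor`: the CM twin anchor

Stub 2b of the skeleton `Cruxes/TwinTwistorTransport/Lines/ordinary_prime_anchors.lean` (lead reshape
r1; registered statement, verbatim, with the same local notations). For a rational lattice
`2`-similitude `M` of `(Λ_ℂ, k3Form)` with rational two-sided inverse `N` (`Latt[M, N]`), granted
the surjectivity of the period map (`K3PeriodSurjective`, route crux stmt-HodgeConjecture-15154),
Buskin's theorem (`HodgeIsometryAlgebraic`, route item stmt-HodgeConjecture-13675) and the named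
literature inputs of the line (`LineFacts[]`): at every projective CM-norm period `x₁` of multiplier
`2` — an eigen-period `J x₁ = t x₁`, `t ∉ ℝ`, of a rational `2`-similitude `J` with rational
two-sided inverse `K` — there is a marked projective `M`-twin pair
`(S₁, η₁, p₁, x₁; S₁', η₁', p₁', x₁')` whose twin similitude `η₁⁻¹ ∘ M ∘ η₁'` is induced by an
algebraic class (`Good`) and whose first surface has complex multiplication.

## Proof

1. Realise `x₁` and the twin period `x₁' := N x₁` (a projective period point, `periodPt_twin`:
   `N` is a rational `½`-similitude) by marked projective K3 surfaces (period surjectivity);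
   `M x₁' = M N x₁ = x₁`.
2. `e := η₁⁻¹ ∘ J ∘ η₁` is `[γ_e]_*` for an algebraic `γ_e` on `S₁ ⊗ S₁` — the anchor theorem
   `CmNormAnchors.stub_cmSelfSimilitude_algebraic` (granted de Rham's theorem, the Hodge conjecture
   for CM squares and the Hodge types of `H²(K3)`, the last now a theorem of the tree); `e` is
   rational, type-preserving and has the non-real eigenvalue `t` on the `(2,0)`-class `η₁⁻¹ x₁`, so
   `S₁` has complex multiplication.
3. `U := K M` is a rational ISOMETRY of `Λ_ℂ` (`(Ka.Kb) = ½ (a.b)`, `(Ma.Mb) = 2 (a.b)`) with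
   `U x₁' = K x₁ = t⁻¹ x₁`, so `u := η₁⁻¹ ∘ U ∘ η₁' : H²(S₁') → H²(S₁)` is rational
   (`isRationalClass_markingConj`), type-preserving (`isOfHodgeType_markingConj`) and isometric for
   the generators of the markings (`cupProduct_markingConj`): `u = [γ_u]_*` with `γ_u` algebraic on
   `S₁ ⊗ S₁'` by Buskin's theorem.
4. `η₁⁻¹ ∘ M ∘ η₁' = e ∘ u` (`J K M = M`), and correspondences compose (`CorrComp[]`, from the named
   fact `cupProduct_mem_algebraicClasses_tripleProduct_surfaces` by the tree's unconditional
   `corrComp_surfaces_of_cup'`).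

References: [Buskin2019] N. Buskin, Every rational Hodge isometry between two K3 surfaces is
algebraic, J. reine angew. Math. 755 (2019), Thm. 1.1, Corollary, §6.2 and Lemma 6.3.
[Huybrechts2019] D. Huybrechts, Motives of isogenous K3 surfaces, Comment. Math. Helv. 94 (2019),
Cor. 0.4 (ii). [Huybrechts2016K3] D. Huybrechts, Lectures on K3 Surfaces, CUP 2016, Ch. 3 Rem. 3.10,
Ch. 6 Thm. 3.1 / Rem. 3.3, Ch. 7 Thm. 4.1.
-/

noncomputable section

open CategoryTheory MonoidalCategory
open scoped Manifold
open Literature.AlgebraicGeometry.Motives Literature.AlgebraicGeometry.HodgeTheory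
open Literature.AlgebraicGeometry.Surfaces
open Literature.AlgebraicTopology.SingularHomology
open Summit.HodgeConjecture.HodgeConjecture.Theses.NikulinTwinTransport
open Summit.HodgeConjecture.HodgeConjecture.Theorems.NikulinTwinTransport

namespace Summit.HodgeConjecture.HodgeConjecture.Theorems.NikulinTwinTransport.OrdinaryPrimeAnchors

/-! ### Local notations — verbatim the notation blocks A, B, C of the line skeleton
(`Cruxes/TwinTwistorTransport/Lines/ordinary_prime_anchors.lean`; Theorems files carry no defs) -/

/-- `MarkedK3[S, η, p, x]`: a marked K3 surface with period `x` (shape of the conclusion of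
`Huybrechts_K3_marking_exists`). Local notation only, verbatim from the line skeleton. -/
local notation3 (prettyPrint := false) "MarkedK3[" S ", " η ", " p ", " x "]" =>
  (IsIntegralClass p ∧
    (∀ q : complexBetti S (2 * 2), IsIntegralClass q → ∃ n : ℤ, q = n • p) ∧
    (∀ c : complexBetti S (2 * 1), IsIntegralClass c ↔ ∃ v : K3Index → ℤ, η c = fun i => (v i : ℂ)) ∧
    (∀ a b : complexBetti S (2 * 1),
        cupProduct (rfl : 2 * 1 + 2 * 1 = 2 * 2) a b = k3Form (η a) (η b) • p) ∧
    IsOfHodgeType 2 S (2 * 1) 2 0 (LinearEquiv.symm η x) ∧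
    (∀ τ : complexBetti S (2 * 1), IsOfHodgeType 2 S (2 * 1) 2 0 τ → ∃ t : ℂ, τ = t • LinearEquiv.symm η x))

/-- `PeriodPt[x]`: `(x.x) = 0`, `(x̄.x) > 0`, a positive lattice vector in `x^⊥`. Local notation
only, verbatim from the line skeleton. -/
local notation3 (prettyPrint := false) "PeriodPt[" x "]" =>
  (k3Form x x = 0 ∧ 0 < (k3Form (star x) x).re ∧
    ∃ u : K3Index → ℤ, k3Form (fun i => (u i : ℂ)) x = 0 ∧ 0 < ∑ i, ∑ j, u i * k3Gram i j * u j)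

/-- `Corr[μ, S, S', hS, hS' ; γ, y] = [γ]_* y = fst_* (snd^* y ∪ γ)`. Local notation only, verbatim
from the line skeleton. -/
local notation3 (prettyPrint := false) "Corr[" μ ", " S ", " S' ", " hS ", " hS' " ; " γ ", " y "]" =>
  complexGysin μ
    (IsSmoothProjective.tensor_holds (IsK3Surface.isSmoothProjective hS)
      (IsK3Surface.isSmoothProjective hS'))
    (IsK3Surface.isSmoothProjective hS) (SemiCartesianMonoidalCategory.fst S S')
    (rfl : 2 * 1 + 2 * 2 + 2 * 2 = 2 * 1 + 2 * (2 + 2))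
    (cupProduct (rfl : 2 * 1 + 2 * 2 = 2 * 1 + 2 * 2)
      (complexBetti.map (SemiCartesianMonoidalCategory.snd S S') (2 * 1) y) γ)

/-- `Latt[M, N]`: `M` is a rational `2`-similitude of `(Λ_ℂ, k3Form)` with rational two-sided inverse `N`
(verbatim the conclusion of `exists_twoSimilitude_k3Lattice`). Local notation only, verbatim from
the line skeleton. -/
local notation3 (prettyPrint := false) "Latt[" M ", " N "]" =>
  ((∀ v : K3Index → ℤ, ∃ w : K3Index → ℚ, M (fun i => (v i : ℂ)) = fun i => (w i : ℂ)) ∧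
    (∀ v : K3Index → ℤ, ∃ w : K3Index → ℚ, N (fun i => (v i : ℂ)) = fun i => (w i : ℂ)) ∧
    M * N = 1 ∧ N * M = 1 ∧
    (∀ a b, k3Form (M a) (M b) = 2 * k3Form a b))

/-- `Good[M, μ, S, S', hS, hS', η, η']`: the twin similitude `η⁻¹ ∘ M ∘ η'` is induced by an algebraic class.
Local notation only, verbatim from the line skeleton. -/
local notation3 (prettyPrint := false) "Good[" M ", " μ ", " S ", " S' ", " hS ", " hS' ", " η ", " η' "]" =>
  ∃ γ ∈ algebraicClasses (MonoidalCategoryStruct.tensorObj S S') 2,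
    ∀ y : complexBetti S' (2 * 1), (η : complexBetti S (2 * 1) ≃ₗ[ℂ] (K3Index → ℂ)).symm
      (M ((η' : complexBetti S' (2 * 1) ≃ₗ[ℂ] (K3Index → ℂ)) y)) = Corr[μ, S, S', hS, hS' ; γ, y]

/-- `CorrComp[]`: composition of algebraic correspondences between K3 surfaces is induced by an algebraic class
(verbatim the hypothesis `hcomp` of `twinSimilitudeAlgebraic_of_twinTransport`; Buskin Lemma 6.3 / Fulton Prop. 16.1.1).
Local notation only, verbatim from the line skeleton. -/
local notation3 (prettyPrint := false) "CorrComp[]" =>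
  ∀ (μ : OrientationFamily), μ.HasPoincareDuality →
    ∀ (S S' S'' : SchemeOver ℂ) (hS : IsK3Surface S) (hS' : IsK3Surface S') (hS'' : IsK3Surface S''),
    ∀ γ ∈ algebraicClasses (MonoidalCategoryStruct.tensorObj S S') 2,
    ∀ γ' ∈ algebraicClasses (MonoidalCategoryStruct.tensorObj S' S'') 2,
    ∃ γ'' ∈ algebraicClasses (MonoidalCategoryStruct.tensorObj S S'') 2,
      ∀ y : complexBetti S'' (2 * 1),
        Corr[μ, S, S'', hS, hS'' ; γ'', y] = Corr[μ, S, S', hS, hS' ; γ, Corr[μ, S', S'', hS', hS'' ; γ', y]]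

/-- `RatEnd[J]`: the endomorphism `J` of `Λ_ℂ` is defined over `ℚ` (verbatim from `Theorems…CmNormDense`).
Local notation only, verbatim from the line skeleton. -/
local notation3 (prettyPrint := false) "RatEnd[" J "]" =>
  ∀ v : K3Index → ℤ, ∃ w : K3Index → ℚ, J (fun i => (v i : ℂ)) = fun i => (w i : ℂ)

/-- `CMNormPeriod[c, x]`: `x` is a CM-norm period of multiplier `c` — an eigen-period, with NON-REAL eigenvalue, of a
rational `c`-similitude `J` of `(Λ_ℂ, k3Form)` with rational two-sided inverse `K` (verbatim the notation of
`Theorems/NikulinTwinTransportHodgeSimilitudeAlgebraicCmNormDense.lean`, whose `exists_cmNormPeriod 2` is the seed).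
Local notation only, verbatim from the line skeleton. -/
local notation3 (prettyPrint := false) "CMNormPeriod[" c ", " x "]" =>
  ∃ (J K : Module.End ℂ (K3Index → ℂ)), RatEnd[J] ∧ RatEnd[K] ∧ J * K = 1 ∧ K * J = 1 ∧
    (∀ a b, k3Form (J a) (J b) = c * k3Form a b) ∧ ∃ t : ℂ, t.im ≠ 0 ∧ J x = t • x

/-- `DeRham[]`: de Rham's theorem in multiplicative form for every finite-dimensional complex model space (the tree's
named fact `Literature.NumberTheory.Transcendental.exists_deRhamIsoFamily`; the only source of the bigrading of the
cup product on the fourfold `S ⊗ S`, consumed by the anchor theorem `CmNormAnchors.stub_cmSelfSimilitude_algebraic`).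
Local notation only, verbatim from the line skeleton. -/
local notation3 (prettyPrint := false) "DeRham[]" =>
  ∀ (E : Type) [NormedAddCommGroup E] [NormedSpace ℂ E] [FiniteDimensional ℂ E],
    Literature.NumberTheory.Transcendental.exists_deRhamIsoFamily 𝓘(ℝ, E)

/-- `LineFacts[]` (reshape r1 of the planner's `K3Facts[]`): the named LITERATURE inputs of the line still unproved, as
one conjunction — existence of markings (`Huybrechts_K3_marking_exists`), cup products of algebraic classes on triple
products of surfaces (`cupProduct_mem_algebraicClasses_tripleProduct_surfaces`, which gives `CorrComp[]` by the tree's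
`corrComp_surfaces_of_cup'`), the Hodge conjecture for squares of CM K3 surfaces
(`Buskin2019_hodgeConjectureFor_square_of_CM`) and de Rham's theorem (`DeRham[]`).  Period surjectivity and Buskin's theorem
are NOT here: they are the route items `K3PeriodSurjective` (15154) and `HodgeIsometryAlgebraic` (13675), hypotheses of the
composition BY NAME (route fact policy); `Huybrechts_K3_hodgeTypes_H2` is a theorem (`_holds`).
Local notation only, verbatim from the line skeleton. -/
local notation3 (prettyPrint := false) "LineFacts[]" =>
  (Huybrechts_K3_marking_exists ∧ cupProduct_mem_algebraicClasses_tripleProduct_surfaces ∧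
    Buskin2019_hodgeConjectureFor_square_of_CM ∧ DeRham[])

/-! ### Two book-keeping lemmas -/

/-- `CorrComp[]` (composition of algebraic correspondences between K3 surfaces) from the named fact
`cupProduct_mem_algebraicClasses_tripleProduct_surfaces`, by the tree's unconditional
`corrComp_surfaces_of_cup'` (Gysin base change from the Künneth theorem; verbatim the skeleton's
`corrComp_of_cupAlg`). [cite: Buskin2019, Lemma 6.3] -/
theorem corrComp_of_cupAlg (hCUP : cupProduct_mem_algebraicClasses_tripleProduct_surfaces) : CorrComp[] :=
  fun μ hμ S S' S'' hS hS' hS'' =>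
    corrComp_surfaces_of_cup' hCUP μ hμ S S' S'' (IsK3Surface.isSmoothProjective hS)
      (IsK3Surface.isSmoothProjective hS') (IsK3Surface.isSmoothProjective hS'')

/-- The two-sided inverse `K` of a `2`-similitude `J` of `(Λ_ℂ, k3Form)` is a `½`-similitude:
`(Ka.Kb) = ½ (a.b)`. [folklore] -/
theorem k3Form_inv_of_twoSimilitude {J K : Module.End ℂ (K3Index → ℂ)} (hJK : J * K = 1)
    (hJ2 : ∀ a b, k3Form (J a) (J b) = 2 * k3Form a b) (a b : K3Index → ℂ) :
    k3Form (K a) (K b) = (2 : ℂ)⁻¹ * k3Form a b := by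
  have h := hJ2 (K a) (K b)
  rw [← Module.End.mul_apply, ← Module.End.mul_apply, hJK, Module.End.one_apply,
    Module.End.one_apply] at h
  rw [h]
  ring

/-! ### The stub -/

/-- **Stub 2b — `stub_cmTwinAnchor`, THE CM TWIN ANCHOR (registered statement, verbatim).** For every
rational lattice `2`-similitude `(M, N)`, granted period surjectivity (`K3PeriodSurjective`), Buskin's
theorem (`HodgeIsometryAlgebraic`) and `LineFacts[]`: at every projective CM-norm period `x₁` of
multiplier `2` there is a marked projective `M`-twin pair `(S₁, η₁, p₁, x₁; S₁', η₁', p₁', x₁')`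
whose twin similitude `η₁⁻¹ ∘ M ∘ η₁'` is ALGEBRAIC (`Good`) and whose first surface has complex
multiplication. Proof: realise `x₁` and `x₁' := N x₁` by marked projective K3 surfaces;
`η₁⁻¹ M η₁' = (η₁⁻¹ J η₁) ∘ (η₁⁻¹ (K M) η₁')` with the first factor algebraic by the anchor theorem
`CmNormAnchors.stub_cmSelfSimilitude_algebraic` (and witnessing `HasComplexMultiplication S₁`), the
second a rational Hodge ISOMETRY with matched periods (`K M (N x₁) = t⁻¹ x₁`), algebraic by Buskin;
compose (`CorrComp[]`).
[cite: Buskin2019, Thm. 1.1, Corollary and §6.2 (Lemma 6.3)] [cite: Huybrechts2019, Cor. 0.4 (ii)] -/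
theorem stub_cmTwinAnchor : ∀ (M N : Module.End ℂ (K3Index → ℂ)), Latt[M, N] →
    ∀ (μ : OrientationFamily), μ.HasPoincareDuality → K3PeriodSurjective → HodgeIsometryAlgebraic → LineFacts[] →
      ∀ (x₁ : K3Index → ℂ), PeriodPt[x₁] → CMNormPeriod[(2 : ℂ), x₁] →
        ∃ (S₁ S₁' : SchemeOver ℂ) (hS₁ : IsK3Surface S₁) (hS₁' : IsK3Surface S₁')
          (η₁ : complexBetti S₁ (2 * 1) ≃ₗ[ℂ] (K3Index → ℂ)) (p₁ : complexBetti S₁ (2 * 2))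
          (η₁' : complexBetti S₁' (2 * 1) ≃ₗ[ℂ] (K3Index → ℂ)) (p₁' : complexBetti S₁' (2 * 2)) (x₁' : K3Index → ℂ),
          MarkedK3[S₁, η₁, p₁, x₁] ∧ MarkedK3[S₁', η₁', p₁', x₁'] ∧ PeriodPt[x₁'] ∧
          (∃ t : ℂ, M x₁' = t • x₁) ∧ HasComplexMultiplication S₁ ∧
          Good[M, μ, S₁, S₁', hS₁, hS₁', η₁, η₁'] := by
  intro M N hlatt μ hμ hP hB hF x₁ hx₁ hcm
  obtain ⟨hMrat, hNrat, hMN, -, hM2⟩ := hlatt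
  obtain ⟨-, hCUP, hBsq, hdR⟩ := hF
  obtain ⟨J, K, hJrat, hKrat, hJK, hKJ, hJ2, t, htim, hJx⟩ := hcm
  have hHT : Huybrechts_K3_hodgeTypes_H2 := Huybrechts_K3_hodgeTypes_H2_holds
  -- (0) `N` and `K` are `½`-similitudes; `M N = 1`, `J K = 1`, `K J = 1` pointwise
  have hN : ∀ a b, k3Form (N a) (N b) = (2 : ℂ)⁻¹ * k3Form a b :=
    k3Form_inv_of_twoSimilitude hMN hM2
  have hK : ∀ a b, k3Form (K a) (K b) = (2 : ℂ)⁻¹ * k3Form a b :=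
    k3Form_inv_of_twoSimilitude hJK hJ2
  have hMNx : ∀ z, M (N z) = z := fun z => by
    rw [← Module.End.mul_apply, hMN, Module.End.one_apply]
  have hJKx : ∀ z, J (K z) = z := fun z => by
    rw [← Module.End.mul_apply, hJK, Module.End.one_apply]
  have hKJx : ∀ z, K (J z) = z := fun z => by
    rw [← Module.End.mul_apply, hKJ, Module.End.one_apply]
  have ht0 : t ≠ 0 := by
    rintro rfl
    exact htim Complex.zero_im
  -- (1) realise `x₁` by a marked projective K3 surface (period surjectivity)
  obtain ⟨S₁, hS₁K3, η₁, p₁, hm₁⟩ := hP x₁ hx₁.1 hx₁.2.1 hx₁.2.2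
  have hS₁ : IsK3Surface S₁ := hS₁K3
  -- (2) realise the twin period `N x₁` likewise; `M (N x₁) = x₁`
  have hx₁' : PeriodPt[N x₁] := periodPt_twin N hNrat hN hx₁
  obtain ⟨S₁', hS₁'K3, η₁', p₁', hm₁'⟩ := hP (N x₁) hx₁'.1 hx₁'.2.1 hx₁'.2.2
  have hS₁' : IsK3Surface S₁' := hS₁'K3
  have hper : ∃ s : ℂ, M (N x₁) = s • x₁ := ⟨1, by rw [hMNx, one_smul]⟩
  obtain ⟨hpint₁, hgen₁, hint₁, hcup₁, h20₁, -⟩ := id hm₁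
  obtain ⟨hpint₁', hgen₁', hint₁', hcup₁', h20₁', -⟩ := id hm₁'
  have hx₁pos : 0 < (k3Form (star x₁) x₁).re := hx₁.2.1
  have hx₁'pos : 0 < (k3Form (star (N x₁)) (N x₁)).re := hx₁'.2.1
  have hp₁0 : p₁ ≠ 0 := generator_ne_zero hS₁ hgen₁
  have hp₁'0 : p₁' ≠ 0 := generator_ne_zero hS₁' hgen₁'
  have hσ0 : η₁.symm x₁ ≠ 0 := fun h0 =>
    ne_zero_of_star_self_re_pos hx₁pos (by simpa using congrArg η₁ h0)
  -- (3) the CM self-similitude `e = η₁⁻¹ J η₁` is algebraic on `S₁ ⊗ S₁` (the anchor theorem)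
  obtain ⟨γe, hγe, hγe_eq⟩ := CmNormAnchors.stub_cmSelfSimilitude_algebraic hdR hBsq hHT (2 : ℂ)
    two_ne_zero J hJrat hJ2 x₁ t htim hJx μ hμ S₁ hS₁ η₁ p₁ hm₁ hx₁
  -- (4) `S₁` has complex multiplication, witnessed by `e`
  obtain ⟨e, he⟩ : ∃ e : complexBetti S₁ (2 * 1) →ₗ[ℂ] complexBetti S₁ (2 * 1),
      ∀ y, e y = η₁.symm (J (η₁ y)) :=
    ⟨η₁.symm.toLinearMap ∘ₗ J ∘ₗ η₁.toLinearMap, fun y => rfl⟩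
  have he_rat : ∀ y, IsRationalClass y → IsRationalClass (e y) := fun y hy => by
    rw [he]
    exact isRationalClass_markingConj η₁ η₁ J hS₁ hS₁ hint₁ hint₁ hJrat hy
  have he_typ : ∀ (i j : ℕ) y, IsOfHodgeType 2 S₁ (2 * 1) i j y →
      IsOfHodgeType 2 S₁ (2 * 1) i j (e y) := fun i j y hy => by
    rw [he]
    exact isOfHodgeType_markingConj η₁ p₁ x₁ η₁ p₁ x₁ J hHT hS₁ hS₁ hint₁ hcup₁ h20₁ hx₁pos hint₁
      hcup₁ hp₁0 h20₁ hx₁pos hJrat two_ne_zero hJ2 ⟨t, hJx⟩ i j y hy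
  have heσ : e (η₁.symm x₁) = t • η₁.symm x₁ := by
    rw [he, LinearEquiv.apply_symm_apply, hJx, map_smul]
  have hCM : HasComplexMultiplication S₁ :=
    ⟨e, he_rat, fun i j y hy => he_typ i j y hy, η₁.symm x₁, t, h20₁, hσ0, htim, heσ⟩
  -- (5) `U = K M` is a rational isometry with `U (N x₁) = t⁻¹ x₁`; `u = η₁⁻¹ U η₁'` is algebraic (Buskin)
  have hUrat : RatEnd[K * M] := ratEnd_mul K M hKrat hMrat
  have hU1 : ∀ a b, k3Form ((K * M) a) ((K * M) b) = 1 * k3Form a b := fun a b => by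
    rw [Module.End.mul_apply, Module.End.mul_apply, hK, hM2]
    ring
  have hKx : K x₁ = t⁻¹ • x₁ := by
    have h1 := hKJx x₁
    rw [hJx, map_smul] at h1
    calc K x₁ = t⁻¹ • (t • K x₁) := by rw [smul_smul, inv_mul_cancel₀ ht0, one_smul]
      _ = t⁻¹ • x₁ := by rw [h1]
  have hUper : ∃ s : ℂ, (K * M) (N x₁) = s • x₁ :=
    ⟨t⁻¹, by rw [Module.End.mul_apply, hMNx, hKx]⟩
  obtain ⟨u, hu⟩ : ∃ u : complexBetti S₁' (2 * 1) →ₗ[ℂ] complexBetti S₁ (2 * 1),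
      ∀ y, u y = η₁.symm ((K * M) (η₁' y)) :=
    ⟨η₁.symm.toLinearMap ∘ₗ (K * M) ∘ₗ η₁'.toLinearMap, fun y => rfl⟩
  have hu_rat : ∀ y, IsRationalClass y → IsRationalClass (u y) := fun y hy => by
    rw [hu]
    exact isRationalClass_markingConj η₁ η₁' (K * M) hS₁ hS₁' hint₁ hint₁' hUrat hy
  have hu_typ : ∀ (i j : ℕ) y, IsOfHodgeType 2 S₁' (2 * 1) i j y →
      IsOfHodgeType 2 S₁ (2 * 1) i j (u y) := fun i j y hy => by
    rw [hu]
    exact isOfHodgeType_markingConj η₁ p₁ x₁ η₁' p₁' (N x₁) (K * M) hHT hS₁ hS₁' hint₁ hcup₁ h20₁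
      hx₁pos hint₁' hcup₁' hp₁'0 h20₁' hx₁'pos hUrat one_ne_zero hU1 hUper i j y hy
  have hu_iso : ∀ (y z : complexBetti S₁' (2 * 1)) (a : ℂ),
      cupProduct (rfl : 2 * 1 + 2 * 1 = 2 * 2) y z = a • p₁' →
        cupProduct (rfl : 2 * 1 + 2 * 1 = 2 * 2) (u y) (u z) = a • p₁ := fun y z a h => by
    rw [hu, hu, cupProduct_markingConj η₁ p₁ η₁' p₁' (K * M) hp₁'0 hcup₁ hcup₁' hU1 y z a h, one_mul]
  obtain ⟨γu, hγu, hγu_eq⟩ := hB μ hμ S₁ S₁' hS₁ hS₁' p₁ p₁' ⟨hpint₁, hgen₁⟩ ⟨hpint₁', hgen₁'⟩ u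
    hu_rat hu_typ hu_iso
  -- (6) compose: `η₁⁻¹ M η₁' = e ∘ u` (`J K M = M`)
  obtain ⟨γ, hγ, hγeq⟩ := corrComp_of_cupAlg hCUP μ hμ S₁ S₁ S₁' hS₁ hS₁ hS₁' γe hγe γu hγu
  refine ⟨S₁, S₁', hS₁, hS₁', η₁, p₁, η₁', p₁', N x₁, hm₁, hm₁', hx₁', hper, hCM, γ, hγ, fun y => ?_⟩
  have key : η₁.symm (M (η₁' y)) = η₁.symm (J (η₁ (u y))) := by
    rw [hu, LinearEquiv.apply_symm_apply, Module.End.mul_apply, hJKx]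
  have h2 : u y = Corr[μ, S₁, S₁', hS₁, hS₁' ; γu, y] := hγu_eq y
  rw [key, hγe_eq (u y), h2]
  exact (hγeq y).symm

end Summit.HodgeConjecture.HodgeConjecture.Theorems.NikulinTwinTransport.OrdinaryPrimeAnchors

end
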